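import Summits.CriticalPhenomena.PercolationContinuityZ3.Theorems.PercNearOneGluingNoHeavyLowerTailSahiCombTriWShell

/-!
# `TRI_W(a)` WITHOUT the cylinder: the three-family functional `triWGen U F G`, its typed conjecture, the bridge to `TriWIneq`,
# and the proved one-index-coordinate case (the SIX-UP-SET inequality)

Support file of the one-cut programme (crux `NoHeavyLowerTail`, stmt-CriticalPhenomena-4575; cell `prim-masterthm`, seat P5 gen 18;
memo `FROM-prim-masterthm-p5-g18-SYMMETRIC-MASTER-FORM.md`).

`FiveUpSet.triW P F G` (`…SahiCombTriWGeneral`) is the case `U x ≡ P` (a CONSTANT family) of the three-family functional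

  `triWGen U F G = Σ_x [ 2·#(U x ∩ F x ∩ G x) − #(U x ∩ F x ∩ refl (G xᶜ)) − #(refl (U xᶜ) ∩ F x ∩ G x)
                        − #(U x ∩ refl (F xᶜ) ∩ G x) + #(U x ∩ refl (F xᶜ) ∩ G xᶜ) ]`

for THREE families `U F G : Finset β → Finset (Finset γ)` (index cube `Finset β` with antipode `x ↦ xᶜ`, cube `Finset γ` with antipode
`refl`).  Census (gen 18, exact C; `code18/c/genU.c`, kit jobs on stmt-4575): for MONOTONE families of up-sets `triWGen U F G ≥ 0` has
0 violations on every `(n,a)` with `n + a ≤ 4` EXHAUSTIVELY over all `(U,F,G)` (4.74 M triples per cell) and in 2.3e7 sampled triples on the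
cells with `n + a = 5` — i.e. the cylinder hypothesis on the first argument of `triW` is (conjecturally) NOT NEEDED.  In the product-cube
dictionary (`Ω = Finset β × Finset γ`, `σ` = full antipode, `κ` = antipode of the `γ`-block) this is
`2|𝒰𝔽𝔾| − |𝒰𝔽σ𝔾| − |σ𝒰𝔽𝔾| − |𝒰σ𝔽𝔾| + |𝒰σ𝔽κ𝔾| ≥ 0` for three arbitrary up-sets of `Ω`, and swapping the roles of the two blocks
together with `𝒰 ↔ 𝔽` leaves the functional invariant (so the two blocks play symmetric roles; memo §2).  It is the case
`(a,b,c) = (0, 1̂, 1_γ)` of the fully symmetric TRANSLATE form (SYM) of the memo (§3).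

* `FiveUpSet.triWGenTerm`, `FiveUpSet.triWGen` — the summand and the functional;
* **`FiveUpSet.triWGen_const_eq_triW`** — `triWGen F (fun _ => P) G = triW P F G` (the tree's functional is the constant-family case,
  with the cylinder in the MIDDLE slot; one summand is re-indexed by `x ↦ xᶜ`, two are rewritten through `refl`);
* `FiveUpSet.TriWGenIneq` (`@[conjecture]`, an obligation of our theory, never a fact) — `0 ≤ triWGen U F G` for monotone families of
  up-sets; **`FiveUpSet.triWIneq_of_triWGenIneq : TriWGenIneq → TriWIneq`**;
* **`FiveUpSet.sixUpSet_le`** — the SIX-UP-SET INEQUALITY (proved): for up-sets `U₀ ⊆ U₁`, `F₀ ⊆ F₁`, `G₀ ⊆ G₁` of a cube,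
  `#(refl F₀ ∩ (U₁\U₀) ∩ (G₁\G₀)) + #(U₀∩F₀∩refl G₁) + #(U₁∩F₁∩refl G₀) + #(refl U₁∩F₀∩G₀) + #(refl U₀∩F₁∩G₁) ≤ 2#(U₀∩F₀∩G₀) + 2#(U₁∩F₁∩G₁)`
  (= `TRI_W(1) ≥ 0` when `F₀ = F₁`); proof: the five-up-set THEOREM at `P = F₁`, two Kleitman lemmas, and three pairwise disjoint
  subfamilies of `U₁ ∩ F₁ ∩ G₁`;
* **`FiveUpSet.triWGen_nonneg_of_card_eq_one`** — `TriWGenIneq` for index cubes with ONE coordinate (`Fintype.card β = 1`), all cubes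
  `Finset γ`, all three monotone families (no cylinder): by `sixUpSet_le` plus one more non-negative shell term.
HONEST LABEL: a definition, an identity, a typed conjecture with its reduction to the crux target, and the proved thin case; `TriWGenIneq`
and `TriWIneq` (a ≥ 2) remain OPEN. [this work]
-/

namespace Summit.CriticalPhenomena.PercolationContinuityZ3.Theorems

namespace FiveUpSet

open Finset

variable {β γ : Type} [DecidableEq β] [Fintype β] [DecidableEq γ] [Fintype γ]

/-! ### The three-family functional -/

/-- The summand at the index `x` of the three-family triangle functional (memo §1, "Form I"):
`2·#(U x ∩ F x ∩ G x) − #(U x ∩ F x ∩ refl (G xᶜ)) − #(refl (U xᶜ) ∩ F x ∩ G x) − #(U x ∩ refl (F xᶜ) ∩ G x) + #(U x ∩ refl (F xᶜ) ∩ G xᶜ)`.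
[this work] -/
def triWGenTerm (U F G : Finset β → Finset (Finset γ)) (x : Finset β) : ℤ :=
  2 * ((U x ∩ F x ∩ G x).card : ℤ) - (U x ∩ F x ∩ refl (G xᶜ)).card - (refl (U xᶜ) ∩ F x ∩ G x).card
    - (U x ∩ refl (F xᶜ) ∩ G x).card + (U x ∩ refl (F xᶜ) ∩ G xᶜ).card

/-- **The three-family triangle functional** `triWGen U F G = Σ_x triWGenTerm U F G x` (no cylinder hypothesis on any argument). [this work] -/
def triWGen (U F G : Finset β → Finset (Finset γ)) : ℤ :=
  ∑ x : Finset β, triWGenTerm U F G x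

/-- Summand comparison with the tree's `triWTerm`: for the CONSTANT middle family `x ↦ P`,
`triWGenTerm F (fun _ => P) G x = triWTerm P F G x + (#(P ∩ refl (F x) ∩ G xᶜ) − #(P ∩ refl (F xᶜ) ∩ G x))`
(the second antipodal count of `triWTerm` sits at `xᶜ` in `triWGenTerm`). [this work] -/
theorem triWGenTerm_const (P : Finset (Finset γ)) (F G : Finset β → Finset (Finset γ)) (x : Finset β) :
    triWGenTerm F (fun _ => P) G x
      = triWTerm P F G x + (((P ∩ refl (F x) ∩ G xᶜ).card : ℤ) - (P ∩ refl (F xᶜ) ∩ G x).card) := by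
  have h1 : F x ∩ P ∩ G x = P ∩ F x ∩ G x := by rw [inter_comm (F x) P]
  have h2 : F x ∩ P ∩ refl (G xᶜ) = P ∩ F x ∩ refl (G xᶜ) := by rw [inter_comm (F x) P]
  have h3 : refl (F xᶜ) ∩ P ∩ G x = P ∩ refl (F xᶜ) ∩ G x := by rw [inter_comm (refl (F xᶜ)) P]
  have h4 : ((F x ∩ refl P ∩ G x).card : ℤ) = (P ∩ refl (F x) ∩ refl (G x)).card := by
    rw [inter_comm (F x) (refl P)]
    exact_mod_cast card_refl_inter_inter P (F x) (G x)
  have h5 : ((F x ∩ refl P ∩ G xᶜ).card : ℤ) = (P ∩ refl (F x) ∩ refl (G xᶜ)).card := by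
    rw [inter_comm (F x) (refl P)]
    exact_mod_cast card_refl_inter_inter P (F x) (G xᶜ)
  unfold triWGenTerm triWTerm
  rw [h1, h2, h3, h4, h5]
  ring

/-- **The tree's functional is the constant-family case**: `triWGen F (fun _ => P) G = triW P F G` (the family `F` in the first slot,
the cylinder `P` as the constant MIDDLE family).  The correction terms of `triWGenTerm_const` cancel after the re-indexing `x ↦ xᶜ`. [this work] -/
theorem triWGen_const_eq_triW (P : Finset (Finset γ)) (F G : Finset β → Finset (Finset γ)) :
    triWGen F (fun _ => P) G = triW P F G := by
  unfold triWGen triW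
  have hre : ∑ x : Finset β, ((P ∩ refl (F xᶜ) ∩ G x).card : ℤ)
      = ∑ x : Finset β, ((P ∩ refl (F x) ∩ G xᶜ).card : ℤ) :=
    Fintype.sum_equiv (complEquiv β) _ _ (fun x => by simp [complEquiv, compl_compl])
  calc ∑ x : Finset β, triWGenTerm F (fun _ => P) G x
      = ∑ x : Finset β, (triWTerm P F G x + (((P ∩ refl (F x) ∩ G xᶜ).card : ℤ) - (P ∩ refl (F xᶜ) ∩ G x).card)) :=
        sum_congr rfl fun x _ => triWGenTerm_const P F G x
    _ = ∑ x : Finset β, triWTerm P F G x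
          + (∑ x : Finset β, ((P ∩ refl (F x) ∩ G xᶜ).card : ℤ) - ∑ x : Finset β, ((P ∩ refl (F xᶜ) ∩ G x).card : ℤ)) := by
        rw [sum_add_distrib, sum_sub_distrib]
    _ = ∑ x : Finset β, triWTerm P F G x := by rw [hre]; ring

/-! ### The typed conjecture and the bridge to the crux target -/

/-- **`triWGen ≥ 0` for three monotone families of up-sets** (CONJECTURE — an obligation of our theory, never a fact; memo §1).  For finite
cubes `Finset β`, `Finset γ` and MONOTONE families `U F G : Finset β → Finset (Finset γ)` of up-sets: `0 ≤ triWGen U F G`.  Census (gen 18):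
exhaustive over all triples of monotone up-set families on every cell `#γ + #β ≤ 4`, sampled on `#γ + #β = 5` (2.3e7 triples): 0 violations,
tight.  The case `U ≡ P` is `TriWIneq` (`triWIneq_of_triWGenIneq`); the case `Fintype.card β = 1` is PROVED below
(`triWGen_nonneg_of_card_eq_one`).  It is the special translate `(0, 1̂, 1_γ)` of the symmetric conjecture (SYM) of the memo. OPEN. [this work] -/
@[conjecture] def TriWGenIneq : Prop :=
  ∀ (β γ : Type) [DecidableEq β] [Fintype β] [DecidableEq γ] [Fintype γ]
    (U F G : Finset β → Finset (Finset γ)),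
    (∀ x, IsUpperSet (U x : Set (Finset γ))) → (∀ x, IsUpperSet (F x : Set (Finset γ))) → (∀ x, IsUpperSet (G x : Set (Finset γ))) →
    Monotone U → Monotone F → Monotone G → 0 ≤ triWGen U F G

/-- **`TriWGenIneq → TriWIneq`**: the crux target is the constant-family case of the three-family conjecture. [this work] -/
theorem triWIneq_of_triWGenIneq (h : TriWGenIneq) : TriWIneq := by
  intro β γ _ _ _ _ P F G hP hF hG hFm hGm
  rw [← triWGen_const_eq_triW P F G]
  exact h β γ F (fun _ => P) G hF (fun _ => hP) hG hFm (fun _ _ _ => le_rfl) hGm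


/-! ### The six-up-set inequality (the one-index-coordinate case, proved) -/

omit [Fintype γ] in
/-- Splitting the last factor of a triple intersection along `C₀ ⊆ C₁`. [this work] -/
theorem card_inter_inter_split_right (A B C₀ C₁ : Finset (Finset γ)) (h : C₀ ⊆ C₁) :
    (A ∩ B ∩ C₁).card = (A ∩ B ∩ C₀).card + (A ∩ B ∩ (C₁ \ C₀)).card := by
  have hu : A ∩ B ∩ C₁ = (A ∩ B ∩ C₀) ∪ (A ∩ B ∩ (C₁ \ C₀)) := by
    ext s; simp only [mem_inter, mem_union, mem_sdiff]
    constructor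
    · rintro ⟨hab, hc⟩
      by_cases h0 : s ∈ C₀
      · exact Or.inl ⟨hab, h0⟩
      · exact Or.inr ⟨hab, hc, h0⟩
    · rintro (⟨hab, h0⟩ | ⟨hab, hc, -⟩)
      · exact ⟨hab, h h0⟩
      · exact ⟨hab, hc⟩
  have hd : Disjoint (A ∩ B ∩ C₀) (A ∩ B ∩ (C₁ \ C₀)) := by
    rw [disjoint_left]
    intro s hs hs'
    simp only [mem_inter, mem_sdiff] at hs hs'
    exact hs'.2.2 hs.2
  rw [hu, card_union_of_disjoint hd]

omit [Fintype γ] in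
/-- Splitting the first factor of a triple intersection along `A₀ ⊆ A₁`. [this work] -/
theorem card_inter_inter_split_left (A₀ A₁ B C : Finset (Finset γ)) (h : A₀ ⊆ A₁) :
    (A₁ ∩ B ∩ C).card = (A₀ ∩ B ∩ C).card + ((A₁ \ A₀) ∩ B ∩ C).card := by
  have e1 : A₁ ∩ B ∩ C = B ∩ C ∩ A₁ := by ext s; simp only [mem_inter]; tauto
  have e2 : A₀ ∩ B ∩ C = B ∩ C ∩ A₀ := by ext s; simp only [mem_inter]; tauto
  have e3 : (A₁ \ A₀) ∩ B ∩ C = B ∩ C ∩ (A₁ \ A₀) := by ext s; simp only [mem_inter]; tauto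
  rw [e1, e2, e3]
  exact card_inter_inter_split_right B C A₀ A₁ h

/-- **THE SIX-UP-SET INEQUALITY** (memo §4, proved).  For up-sets `U₀ ⊆ U₁`, `F₀ ⊆ F₁`, `G₀ ⊆ G₁` of a finite cube:
`#(refl F₀ ∩ (U₁\U₀) ∩ (G₁\G₀)) + #(U₀∩F₀∩refl G₁) + #(U₁∩F₁∩refl G₀) + #(refl U₁∩F₀∩G₀) + #(refl U₀∩F₁∩G₁) ≤ 2#(U₀∩F₀∩G₀) + 2#(U₁∩F₁∩G₁)`.
For `F₀ = F₁ = P` this is `TRI_W(1)(P; U₀,U₁; G₀,G₁) ≥ 0`; in general it is the one-index-coordinate case of `TriWGenIneq` up to a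
non-negative shell term.  PROOF: `#(refl F₀ ∩ Sh) = #(F₀ ∩ refl Sh) ≤ #(F₁ ∩ refl Sh)`; the five-up-set THEOREM with `P = F₁`
absorbs `#(F₁ ∩ refl Sh) + #(U₁∩F₁∩refl G₀) + #(refl U₀∩F₁∩G₁)` into `#(F₁∩U₁∩G₁) + #(F₁∩U₀∩G₀)`; Kleitman's lemma gives
`#(U₀F₀ ∩ refl G₁) ≤ #(U₀F₀G₁)` and `#(refl U₁ ∩ F₀G₀) ≤ #(U₁F₀G₀)`; finally `F₁U₀G₀`, `U₀F₀(G₁\G₀)`, `(U₁\U₀)F₀G₀` are pairwise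
disjoint subfamilies of `U₁F₁G₁`. [this work] -/
theorem sixUpSet_le (U₀ U₁ F₀ F₁ G₀ G₁ : Finset (Finset γ))
    (hU₀ : IsUpperSet (U₀ : Set (Finset γ))) (hU₁ : IsUpperSet (U₁ : Set (Finset γ)))
    (hF₀ : IsUpperSet (F₀ : Set (Finset γ))) (hF₁ : IsUpperSet (F₁ : Set (Finset γ)))
    (hG₀ : IsUpperSet (G₀ : Set (Finset γ))) (hG₁ : IsUpperSet (G₁ : Set (Finset γ)))
    (hU : U₀ ⊆ U₁) (hF : F₀ ⊆ F₁) (hG : G₀ ⊆ G₁) :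
    (refl F₀ ∩ (U₁ \ U₀) ∩ (G₁ \ G₀)).card + (U₀ ∩ F₀ ∩ refl G₁).card + (U₁ ∩ F₁ ∩ refl G₀).card
        + (refl U₁ ∩ F₀ ∩ G₀).card + (refl U₀ ∩ F₁ ∩ G₁).card
      ≤ 2 * (U₀ ∩ F₀ ∩ G₀).card + 2 * (U₁ ∩ F₁ ∩ G₁).card := by
  -- Step 1: the shell term, moved to `F₁`
  have s1 : (refl F₀ ∩ (U₁ \ U₀) ∩ (G₁ \ G₀)).card ≤ (F₁ ∩ refl (U₁ \ U₀) ∩ refl (G₁ \ G₀)).card := by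
    rw [card_refl_inter_inter F₀ (U₁ \ U₀) (G₁ \ G₀)]
    apply card_le_card
    intro s hs
    simp only [mem_inter] at hs ⊢
    exact ⟨⟨hF hs.1.1, hs.1.2⟩, hs.2⟩
  -- Step 2: the five-up-set theorem with `P = F₁`
  have s2 := fiveUpSetIneq_holds γ F₁ U₀ U₁ G₀ G₁ hF₁ hU₀ hU₁ hG₀ hG₁ hU hG
  have e21 : F₁ ∩ U₁ ∩ refl G₀ = U₁ ∩ F₁ ∩ refl G₀ := by rw [inter_comm F₁ U₁]
  have e22 : F₁ ∩ refl U₀ ∩ G₁ = refl U₀ ∩ F₁ ∩ G₁ := by rw [inter_comm F₁ (refl U₀)]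
  have e23 : F₁ ∩ U₁ ∩ G₁ = U₁ ∩ F₁ ∩ G₁ := by rw [inter_comm F₁ U₁]
  rw [e21, e22, e23] at s2
  -- Step 3: two Kleitman lemmas
  have hUF : IsUpperSet ((U₀ ∩ F₀ : Finset (Finset γ)) : Set (Finset γ)) := by rw [coe_inter]; exact hU₀.inter hF₀
  have hFG : IsUpperSet ((F₀ ∩ G₀ : Finset (Finset γ)) : Set (Finset γ)) := by rw [coe_inter]; exact hF₀.inter hG₀
  have k1 : (U₀ ∩ F₀ ∩ refl G₁).card ≤ (U₀ ∩ F₀ ∩ G₁).card := card_inter_refl_le hUF hG₁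
  have k2 : (refl U₁ ∩ (F₀ ∩ G₀)).card ≤ (U₁ ∩ (F₀ ∩ G₀)).card := card_refl_inter_le hFG hU₁
  rw [← inter_assoc, ← inter_assoc] at k2
  -- Step 4: counting inside `U₁ ∩ F₁ ∩ G₁`
  have c1 := card_inter_inter_split_right U₀ F₀ G₀ G₁ hG
  have c2 := card_inter_inter_split_left U₀ U₁ F₀ G₀ hU
  have c3 : (F₁ ∩ U₀ ∩ G₀).card + (U₀ ∩ F₀ ∩ (G₁ \ G₀)).card + ((U₁ \ U₀) ∩ F₀ ∩ G₀).card ≤ (U₁ ∩ F₁ ∩ G₁).card := by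
    have d12 : Disjoint (F₁ ∩ U₀ ∩ G₀) (U₀ ∩ F₀ ∩ (G₁ \ G₀)) := by
      rw [disjoint_left]; intro s hs hs'
      simp only [mem_inter, mem_sdiff] at hs hs'
      exact hs'.2.2 hs.2
    have d3 : Disjoint (F₁ ∩ U₀ ∩ G₀ ∪ U₀ ∩ F₀ ∩ (G₁ \ G₀)) ((U₁ \ U₀) ∩ F₀ ∩ G₀) := by
      rw [disjoint_left]; intro s hs hs'
      simp only [mem_inter, mem_union, mem_sdiff] at hs hs'
      rcases hs with ⟨⟨-, hu⟩, -⟩ | ⟨⟨hu, -⟩, -⟩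
      · exact hs'.1.1.2 hu
      · exact hs'.1.1.2 hu
    have hsub : F₁ ∩ U₀ ∩ G₀ ∪ U₀ ∩ F₀ ∩ (G₁ \ G₀) ∪ (U₁ \ U₀) ∩ F₀ ∩ G₀ ⊆ U₁ ∩ F₁ ∩ G₁ := by
      intro s hs
      simp only [mem_inter, mem_union, mem_sdiff] at hs ⊢
      rcases hs with (⟨⟨hf, hu⟩, hg⟩ | ⟨⟨hu, hf⟩, hg, -⟩) | ⟨⟨⟨hu, -⟩, hf⟩, hg⟩
      · exact ⟨⟨hU hu, hf⟩, hG hg⟩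
      · exact ⟨⟨hU hu, hF hf⟩, hg⟩
      · exact ⟨⟨hu, hF hf⟩, hG hg⟩
    have := card_le_card hsub
    rw [card_union_of_disjoint d3, card_union_of_disjoint d12] at this
    exact this
  omega

/-- `refl` is monotone. [this work] -/
theorem refl_subset_refl {𝒜 ℬ : Finset (Finset γ)} (h : 𝒜 ⊆ ℬ) : refl 𝒜 ⊆ refl ℬ := by
  intro s hs
  rw [mem_refl] at hs ⊢
  exact h hs

/-- For an index type with one element, the index cube is `{∅, univ}`. [this work] -/
theorem univ_finset_eq_pair_of_card_eq_one (hβ : Fintype.card β = 1) :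
    (univ : Finset (Finset β)) = {∅, univ} := by
  ext x
  simp only [mem_univ, mem_insert, mem_singleton, true_iff]
  by_cases h : x = ∅
  · exact Or.inl h
  · right
    obtain ⟨b, hb⟩ := Finset.nonempty_iff_ne_empty.2 h
    exact eq_univ_of_forall fun c => by
      have hcb : c = b := Fintype.card_le_one_iff.1 hβ.le c b
      rw [hcb]; exact hb

/-- **`TriWGenIneq` for index cubes with one coordinate** (`Fintype.card β = 1`; every cube `Finset γ`, all three MONOTONE families of up-sets,
no cylinder hypothesis): `0 ≤ triWGen U F G`.  The two summands (`x = ∅`, `x = univ`) add up to the slack of `sixUpSet_le` plus the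
non-negative term `#(U ∅ ∩ (refl (F univ) \ refl (F ∅)) ∩ (G univ \ G ∅))`. [this work] -/
theorem triWGen_nonneg_of_card_eq_one (hβ : Fintype.card β = 1) (U F G : Finset β → Finset (Finset γ))
    (hU : ∀ x, IsUpperSet (U x : Set (Finset γ))) (hF : ∀ x, IsUpperSet (F x : Set (Finset γ)))
    (hG : ∀ x, IsUpperSet (G x : Set (Finset γ))) (hUm : Monotone U) (hFm : Monotone F) (hGm : Monotone G) :
    0 ≤ triWGen U F G := by
  have hne : (∅ : Finset β) ≠ univ := by
    intro h
    have h0 : Fintype.card β = 0 := by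
      rw [← Finset.card_univ, ← h, card_empty]
    omega
  have hsum : triWGen U F G = triWGenTerm U F G ∅ + triWGenTerm U F G univ := by
    unfold triWGen
    rw [univ_finset_eq_pair_of_card_eq_one hβ, sum_pair hne]
  rw [hsum]
  unfold triWGenTerm
  rw [Finset.compl_empty, Finset.compl_univ]
  -- abbreviations: level 0 = `∅`, level 1 = `univ`
  have hU01 : U ∅ ⊆ U univ := hUm (empty_subset _)
  have hF01 : F ∅ ⊆ F univ := hFm (empty_subset _)
  have hG01 : G ∅ ⊆ G univ := hGm (empty_subset _)
  have six := sixUpSet_le (U ∅) (U univ) (F ∅) (F univ) (G ∅) (G univ) (hU ∅) (hU univ) (hF ∅) (hF univ) (hG ∅) (hG univ)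
    hU01 hF01 hG01
  -- the four remaining antipodal counts
  have e1 := card_inter_inter_split_right (U univ) (refl (F ∅)) (G ∅) (G univ) hG01
  have e2 := card_inter_inter_split_left (U ∅) (U univ) (refl (F ∅)) (G univ \ G ∅) hU01
  have e3 := card_inter_inter_split_right (U ∅) (refl (F univ)) (G ∅) (G univ) hG01
  have i4 : (U ∅ ∩ refl (F ∅) ∩ (G univ \ G ∅)).card ≤ (U ∅ ∩ refl (F univ) ∩ (G univ \ G ∅)).card := by
    apply card_le_card
    intro s hs
    simp only [mem_inter] at hs ⊢
    exact ⟨⟨hs.1.1, refl_subset_refl hF01 hs.1.2⟩, hs.2⟩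
  have e5 : ((U univ \ U ∅) ∩ refl (F ∅) ∩ (G univ \ G ∅)).card = (refl (F ∅) ∩ (U univ \ U ∅) ∩ (G univ \ G ∅)).card := by
    rw [inter_comm (U univ \ U ∅) (refl (F ∅))]
  omega

end FiveUpSet

end Summit.CriticalPhenomena.PercolationContinuityZ3.Theorems
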